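import Summits.QuantumFields.BalabanUV.Beta.GAN24.FourFaceOneCov

/-!
# `BalabanUV.Beta.GAN24.FourFaceOneCovCoincident` — binder row G-an2-4 ∕ (CONV-C), W-slot CT-route (sequel of `GAN24/FourFaceOneCov`, split for the 400-line
# rule; the row owner gan24-p1 g23's R1 (N1) «×9» ∕ R4b «FF(T_0) = Z(T_0)∕9» ∕ R6 «FF∕Z = 1∕9 along the orbit of member 0»): **THE COINCIDENT PATTERN `(κ,κ;a,a)`
# OF A UNIT-COVARIANT TABLE — A RESIDUE-DIAGONAL SLICE COUNT; ON ONE-PLAQUETTE SUPPORTS `N⁴·fourFace = N²·zmode`** (`n²`, not `n^{d+1}`)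

NOT IN PRINT; OUR BOOKKEEPING (G-an2-4 crux team (2), leaf prover `b2b-balaban-gan24-formalise-leaf-02`, gen 52; PART 3b of the kernel certificate of F-leaf02-g52-1).
HONEST FRAMING (cell contract, verbatim): «discharging `BetaPertH` makes Bałaban's UV stability UNCONDITIONAL — a real constructive-QFT result; it is NOT the
continuum limit and NOT the Clay problem.»  HONEST DEPENDENCY (verbatim): «continuum YM on T⁴ ⇐ BetaPertH ∧ nine spine estimates (0/9 proved); BetaPertH ⇐ (D1) ∧
(D4) ∧ CAP+tail; G-an2-4 gates asym, D1 and NE2/3/4.»  [folklore] residue counting; generic `d ≥ 1`, `1 ≤ N`; 0 `def`, 0 cited facts, 0 `def … : Prop`, 0 sorry.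
Discharges NOTHING of (hW, hWall) ∕ «T2Shape»; NEVER «G-an2-4 closed» as (CONV-C); NOT D1, NOT BetaPertH, NOT continuum, NOT Clay.

## What (`Y : Tab d`, `LocStencil₂ Y C δ`, `0 < δ`, UNIT-covariant; `κ ≠ a`)
* `card_filter_range_succ_and_succ` (two shifted face conditions on one coordinate: count `[e₁ ≡ e₂]`), **`card_faceFilter_of_coincident`**
  (`#{…} = [u′_κ ≡ 0 ∧ x_a ≡ z_a (mod N)]·N^{(d+1)−2}`), **`fourFace_mul_eq_of_coincident`** (`N⁴·fourFace = N^{d+3}·(residue-diagonal slice sum)`),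
  **`fourFace_mul_eq_sq_mul_zmode_of_plaquetteSupport`** (one-plaquette supports: `N⁴·fourFace = N²·zmode`).
-/

noncomputable section

open Finset
open scoped BigOperators
open Literature.MathematicalPhysics.QuantumFieldTheory
open Literature.MathematicalPhysics.QuantumFieldTheory.Balaban1983to89
open Literature.MathematicalPhysics.QuantumFieldTheory.Balaban1983to89.Beta
open ExpKernelCalculus (MKer shiftK)
open AffineAveraging (Form1 Site box toSite)
open OneStepResolventKernel (Fib)
open BalabanCompositeJets (LocStencil₂)
open Summit.QuantumFields.BalabanUV.Beta.GAN24.BiStencilZeroMode (Tab zmode)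
open Summit.QuantumFields.BalabanUV.Beta.GAN24.TaylorBlockSum (card_box)
open Summit.QuantumFields.BalabanUV.Beta.GAN24.ZeroModeCoarseCount (inner_const_of_unit_cov)
open Summit.QuantumFields.BalabanUV.Beta.GAN24.FourFaceOneCov (fourFace_eq_card_weighted card_filter_range_emod_succ)

namespace Summit.QuantumFields.BalabanUV.Beta.GAN24.FourFaceOneCovCoincident

variable {d : ℕ} {N : ℕ}

/-! ## The coincident pattern `(κ, κ, a, a)`, `κ ≠ a` (both source bonds in one direction, both kernel legs in another — the Wilson-charged pattern) -/

/-- [folklore] Two shifted face conditions on ONE coordinate: `#{m < N : (m + e₁) % N = N−1 ∧ (m + e₂) % N = N−1}` is `1` if `e₁ ≡ e₂ (mod N)` and `0`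
otherwise (`1 ≤ N`). -/
theorem card_filter_range_succ_and_succ (hN : 1 ≤ N) (e₁ e₂ : ℤ) :
    ((Finset.range N).filter (fun m : ℕ => ((m : ℤ) + e₁) % (N : ℤ) = (N : ℤ) - 1 ∧ ((m : ℤ) + e₂) % (N : ℤ) = (N : ℤ) - 1)).card
      = if e₁ % (N : ℤ) = e₂ % (N : ℤ) then 1 else 0 := by
  by_cases he : e₁ % (N : ℤ) = e₂ % (N : ℤ)
  · rw [if_pos he]
    have e : (Finset.range N).filter (fun m : ℕ => ((m : ℤ) + e₁) % (N : ℤ) = (N : ℤ) - 1 ∧ ((m : ℤ) + e₂) % (N : ℤ) = (N : ℤ) - 1)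
        = (Finset.range N).filter (fun m : ℕ => ((m : ℤ) + e₁) % (N : ℤ) = (N : ℤ) - 1) := by
      ext m
      simp only [Finset.mem_filter, Finset.mem_range]
      have h12 : ((m : ℤ) + e₂) % (N : ℤ) = ((m : ℤ) + e₁) % (N : ℤ) := by
        rw [Int.add_emod, ← he, ← Int.add_emod]
      rw [h12]
      exact ⟨fun h => ⟨h.1, h.2.1⟩, fun h => ⟨h.1, h.2, h.2⟩⟩
    rw [e]
    exact card_filter_range_emod_succ hN e₁
  · rw [if_neg he, Finset.card_eq_zero, Finset.filter_eq_empty_iff]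
    intro m _ h
    apply he
    -- `(m + e₁) % N = (m + e₂) % N` ⇒ `e₁ % N = e₂ % N`
    have h12 : ((m : ℤ) + e₁) % (N : ℤ) = ((m : ℤ) + e₂) % (N : ℤ) := by rw [h.1, h.2]
    have hmod : Int.ModEq (N : ℤ) ((m : ℤ) + e₁) ((m : ℤ) + e₂) := h12
    exact (Int.ModEq.add_left_cancel' (m : ℤ) hmod)

/-- NOT IN PRINT; OUR BOOKKEEPING.  **THE COUNT ON THE COINCIDENT PATTERN `(κ, κ, a, a)`, `κ ≠ a`**: `#{r ∈ box : r_κ ≡ −1, (r+u′)_κ ≡ −1, (r+x)_a ≡ −1, (r+z)_a ≡ −1}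
= [u′_κ ≡ 0 ∧ x_a ≡ z_a (mod N)]·N^{(d+1)−2}` — the two conditions on the `κ`-coordinate are compatible iff the second source bond's relative offset is
`≡ 0` in direction `κ`, the two on the `a`-coordinate iff the two kernel legs have equal residues in direction `a`. -/
theorem card_faceFilter_of_coincident (hN : 1 ≤ N) {κ a : Fin (d + 1)} (hκa : κ ≠ a) (u' x z : Site (d + 1)) :
    ((box (d + 1) N).filter (fun rr => toSite rr κ % (N : ℤ) = (N : ℤ) - 1 ∧ (toSite rr + u') κ % (N : ℤ) = (N : ℤ) - 1 ∧
        (toSite rr + x) a % (N : ℤ) = (N : ℤ) - 1 ∧ (toSite rr + z) a % (N : ℤ) = (N : ℤ) - 1)).card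
      = if (u' κ % (N : ℤ) = 0 ∧ x a % (N : ℤ) = z a % (N : ℤ)) then N ^ (d + 1 - 2) else 0 := by
  -- product structure
  have eprod : (box (d + 1) N).filter (fun rr => toSite rr κ % (N : ℤ) = (N : ℤ) - 1 ∧ (toSite rr + u') κ % (N : ℤ) = (N : ℤ) - 1 ∧
        (toSite rr + x) a % (N : ℤ) = (N : ℤ) - 1 ∧ (toSite rr + z) a % (N : ℤ) = (N : ℤ) - 1)
      = Fintype.piFinset (fun i => (Finset.range N).filter (fun m : ℕ =>
          (i = κ → (((m : ℤ) + 0) % (N : ℤ) = (N : ℤ) - 1 ∧ ((m : ℤ) + u' κ) % (N : ℤ) = (N : ℤ) - 1)) ∧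
          (i = a → (((m : ℤ) + x a) % (N : ℤ) = (N : ℤ) - 1 ∧ ((m : ℤ) + z a) % (N : ℤ) = (N : ℤ) - 1)))) := by
    ext rr
    simp only [Finset.mem_filter, AffineAveraging.box, Fintype.mem_piFinset, Finset.mem_range, toSite, Pi.add_apply, add_zero]
    constructor
    · rintro ⟨hbox, h1, h2, h3, h4⟩ i
      refine ⟨hbox i, ?_, ?_⟩
      · rintro rfl; exact ⟨h1, h2⟩
      · rintro rfl; exact ⟨h3, h4⟩
    · intro h
      refine ⟨fun i => (h i).1, ((h κ).2.1 rfl).1, ((h κ).2.1 rfl).2, ((h a).2.2 rfl).1, ((h a).2.2 rfl).2⟩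
  rw [eprod, Fintype.card_piFinset]
  have hcoord : ∀ i : Fin (d + 1), ((Finset.range N).filter (fun m : ℕ =>
        (i = κ → (((m : ℤ) + 0) % (N : ℤ) = (N : ℤ) - 1 ∧ ((m : ℤ) + u' κ) % (N : ℤ) = (N : ℤ) - 1)) ∧
          (i = a → (((m : ℤ) + x a) % (N : ℤ) = (N : ℤ) - 1 ∧ ((m : ℤ) + z a) % (N : ℤ) = (N : ℤ) - 1)))).card
      = if i = κ then (if (0 : ℤ) % (N : ℤ) = u' κ % (N : ℤ) then 1 else 0)
        else if i = a then (if x a % (N : ℤ) = z a % (N : ℤ) then 1 else 0) else N := by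
    intro i
    by_cases hiκ : i = κ
    · subst hiκ
      rw [if_pos rfl]
      have e : (Finset.range N).filter (fun m : ℕ =>
          (i = i → (((m : ℤ) + 0) % (N : ℤ) = (N : ℤ) - 1 ∧ ((m : ℤ) + u' i) % (N : ℤ) = (N : ℤ) - 1)) ∧
            (i = a → (((m : ℤ) + x a) % (N : ℤ) = (N : ℤ) - 1 ∧ ((m : ℤ) + z a) % (N : ℤ) = (N : ℤ) - 1)))
          = (Finset.range N).filter (fun m : ℕ => ((m : ℤ) + 0) % (N : ℤ) = (N : ℤ) - 1 ∧ ((m : ℤ) + u' i) % (N : ℤ) = (N : ℤ) - 1) := by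
        ext m
        simp only [Finset.mem_filter, Finset.mem_range, true_implies]
        exact ⟨fun h => ⟨h.1, h.2.1⟩, fun h => ⟨h.1, h.2, fun e => absurd e hκa⟩⟩
      rw [e]
      exact card_filter_range_succ_and_succ hN 0 (u' i)
    by_cases hia : i = a
    · subst hia
      rw [if_neg hiκ, if_pos rfl]
      have e : (Finset.range N).filter (fun m : ℕ =>
          (i = κ → (((m : ℤ) + 0) % (N : ℤ) = (N : ℤ) - 1 ∧ ((m : ℤ) + u' κ) % (N : ℤ) = (N : ℤ) - 1)) ∧
            (i = i → (((m : ℤ) + x i) % (N : ℤ) = (N : ℤ) - 1 ∧ ((m : ℤ) + z i) % (N : ℤ) = (N : ℤ) - 1)))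
          = (Finset.range N).filter (fun m : ℕ => ((m : ℤ) + x i) % (N : ℤ) = (N : ℤ) - 1 ∧ ((m : ℤ) + z i) % (N : ℤ) = (N : ℤ) - 1) := by
        ext m
        simp only [Finset.mem_filter, Finset.mem_range, true_implies]
        exact ⟨fun h => ⟨h.1, h.2.2⟩, fun h => ⟨h.1, fun e => absurd e hiκ, h.2⟩⟩
      rw [e]
      exact card_filter_range_succ_and_succ hN (x i) (z i)
    · rw [if_neg hiκ, if_neg hia]
      have e : (Finset.range N).filter (fun m : ℕ =>
          (i = κ → (((m : ℤ) + 0) % (N : ℤ) = (N : ℤ) - 1 ∧ ((m : ℤ) + u' κ) % (N : ℤ) = (N : ℤ) - 1)) ∧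
            (i = a → (((m : ℤ) + x a) % (N : ℤ) = (N : ℤ) - 1 ∧ ((m : ℤ) + z a) % (N : ℤ) = (N : ℤ) - 1))) = Finset.range N := by
        refine Finset.filter_true_of_mem fun m _ => ?_
        exact ⟨fun e => absurd e hiκ, fun e => absurd e hia⟩
      rw [e, Finset.card_range]
  simp_rw [hcoord]
  -- peel the two special coordinates off the product
  rw [← Finset.mul_prod_erase Finset.univ _ (Finset.mem_univ κ), if_pos rfl]
  have ha' : a ∈ Finset.univ.erase κ := Finset.mem_erase.2 ⟨fun h => hκa h.symm, Finset.mem_univ a⟩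
  rw [← Finset.mul_prod_erase _ _ ha', if_neg (fun h : a = κ => hκa h.symm), if_pos rfl]
  have hrest : ∏ i ∈ (Finset.univ.erase κ).erase a,
      (if i = κ then (if (0 : ℤ) % (N : ℤ) = u' κ % (N : ℤ) then 1 else 0)
        else if i = a then (if x a % (N : ℤ) = z a % (N : ℤ) then 1 else 0) else N) = N ^ (d + 1 - 2) := by
    rw [Finset.prod_congr rfl (fun i hi => by
      rw [if_neg (Finset.ne_of_mem_erase (Finset.mem_of_mem_erase hi)), if_neg (Finset.ne_of_mem_erase hi)]), Finset.prod_const]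
    congr 1
    rw [Finset.card_erase_of_mem ha', Finset.card_erase_of_mem (Finset.mem_univ κ), Finset.card_univ, Fintype.card_fin]
    omega
  rw [hrest, Int.zero_emod]
  by_cases h1 : u' κ % (N : ℤ) = 0 <;> by_cases h2 : x a % (N : ℤ) = z a % (N : ℤ)
  · rw [if_pos h1.symm, if_pos h2, if_pos ⟨h1, h2⟩]; ring
  · rw [if_pos h1.symm, if_neg h2, if_neg (not_and_of_not_right _ h2)]; ring
  · rw [if_neg (fun h => h1 h.symm), if_neg (not_and_of_not_left _ h1)]; ring
  · rw [if_neg (fun h => h1 h.symm), if_neg (not_and_of_not_left _ h1)]; ring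

/-- NOT IN PRINT; OUR BOOKKEEPING.  **THE COINCIDENT PATTERN `(κ,κ,a,a)` OF A UNIT-COVARIANT TABLE**: `N⁴·fourFace = N^{d+3}·Σ'_{u′} Σ'_x Σ'_z [u′_κ ≡ 0 ∧ x_a ≡ z_a (mod N)]·Y κ 0 κ u′ x z a′ b′`
(`1 ≤ N`, `1 ≤ d`, `κ ≠ a`) — a RESIDUE-DIAGONAL slice sum: NOT a multiple of the cell charge in general. -/
theorem fourFace_mul_eq_of_coincident (hN : 1 ≤ N) (hd : 1 ≤ d) {Y : Tab d} {C δ : ℝ} (hY : LocStencil₂ Y C δ) (hδ : 0 < δ)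
    (h1 : ∀ κ u κ' u' t, Y κ (u + t) κ' (u' + t) = shiftK (-t) (Y κ u κ' u')) {κ a : Fin (d + 1)} (hκa : κ ≠ a) (a' b' : Fib d) :
    (N : ℝ) ^ 4 * ∑ rr ∈ box (d + 1) N, ∑' u' : Site (d + 1), ∑' x : Site (d + 1), ∑' z : Site (d + 1),
        (if toSite rr κ % (N : ℤ) = (N : ℤ) - 1 ∧ u' κ % (N : ℤ) = (N : ℤ) - 1 ∧ x a % (N : ℤ) = (N : ℤ) - 1 ∧ z a % (N : ℤ) = (N : ℤ) - 1
          then Y κ (toSite rr) κ u' x z a' b' else 0)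
      = (N : ℝ) ^ (d + 3) * ∑' u' : Site (d + 1), ∑' x : Site (d + 1), ∑' z : Site (d + 1),
          (if u' κ % (N : ℤ) = 0 ∧ x a % (N : ℤ) = z a % (N : ℤ) then Y κ 0 κ u' x z a' b' else 0) := by
  rw [fourFace_eq_card_weighted N hY hδ h1 κ κ a a a' b']
  simp_rw [card_faceFilter_of_coincident hN hκa]
  have e : ∀ u' x z : Site (d + 1), (((if (u' κ % (N : ℤ) = 0 ∧ x a % (N : ℤ) = z a % (N : ℤ)) then N ^ (d + 1 - 2) else 0 : ℕ) : ℝ) *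
        Y κ 0 κ u' x z a' b')
      = (N : ℝ) ^ (d + 1 - 2) * (if u' κ % (N : ℤ) = 0 ∧ x a % (N : ℤ) = z a % (N : ℤ) then Y κ 0 κ u' x z a' b' else 0) := by
    intro u' x z
    split_ifs <;> push_cast <;> ring
  simp_rw [e, tsum_mul_left]
  rw [← mul_assoc, ← pow_add]
  congr 2
  omega

/-- NOT IN PRINT; OUR BOOKKEEPING.  **ONE-PLAQUETTE SUPPORTS ON THE COINCIDENT PATTERN: THE FACTOR IS `N²`** (the `9` of the owner's R1 (N1) at `n = 3` — `n²`, not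
`n^{d+1}`): if the table's `(κ,κ,a,a)` slice at the origin is supported on configurations with the second source bond at relative offset `0` in direction `κ`
and the two kernel legs at EQUAL `a`-coordinates (both κ-bonds and both a-bonds of one plaquette — the Wilson `W₂` ∕ member-0 geometry), then
`N⁴ · fourFace_N (Y)(κ,κ,a,a) = N² · zmode N Y κ κ a′ b′` (`1 ≤ N`, `1 ≤ d`, unit-covariant `LocStencil₂` `Y`). -/
theorem fourFace_mul_eq_sq_mul_zmode_of_plaquetteSupport (hN : 1 ≤ N) (hd : 1 ≤ d) {Y : Tab d} {C δ : ℝ} (hY : LocStencil₂ Y C δ) (hδ : 0 < δ)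
    (h1 : ∀ κ u κ' u' t, Y κ (u + t) κ' (u' + t) = shiftK (-t) (Y κ u κ' u')) {κ a : Fin (d + 1)} (hκa : κ ≠ a) (a' b' : Fib d)
    (hsupp : ∀ u' x z : Site (d + 1), Y κ 0 κ u' x z a' b' ≠ 0 → u' κ = 0 ∧ x a = z a) :
    (N : ℝ) ^ 4 * ∑ rr ∈ box (d + 1) N, ∑' u' : Site (d + 1), ∑' x : Site (d + 1), ∑' z : Site (d + 1),
        (if toSite rr κ % (N : ℤ) = (N : ℤ) - 1 ∧ u' κ % (N : ℤ) = (N : ℤ) - 1 ∧ x a % (N : ℤ) = (N : ℤ) - 1 ∧ z a % (N : ℤ) = (N : ℤ) - 1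
          then Y κ (toSite rr) κ u' x z a' b' else 0)
      = (N : ℝ) ^ 2 * zmode N Y κ κ a' b' := by
  rw [fourFace_mul_eq_of_coincident hN hd hY hδ h1 hκa a' b']
  -- the mask is invisible on the support
  have e : ∀ u' x z : Site (d + 1), (if u' κ % (N : ℤ) = 0 ∧ x a % (N : ℤ) = z a % (N : ℤ) then Y κ 0 κ u' x z a' b' else 0)
      = Y κ 0 κ u' x z a' b' := by
    intro u' x z
    by_cases hY0 : Y κ 0 κ u' x z a' b' = 0
    · rw [hY0, ite_self]
    · obtain ⟨hu, hxz⟩ := hsupp u' x z hY0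
      rw [if_pos ⟨by rw [hu, Int.zero_emod], by rw [hxz]⟩]
  simp_rw [e]
  -- the cell charge is `N^{d+1}` slices at the origin
  unfold zmode
  rw [Finset.sum_congr rfl fun rr _ => inner_const_of_unit_cov h1 κ κ a' b' (toSite rr), Finset.sum_const, card_box, nsmul_eq_mul]
  push_cast
  rw [← mul_assoc, ← pow_add, show 2 + (d + 1) = d + 3 by omega]

end Summit.QuantumFields.BalabanUV.Beta.GAN24.FourFaceOneCovCoincident

end
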